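import Summits.ABC.IUTFork.Cor312PilotIdelesMThetaSide
import Summits.ABC.IUTFork.Cor312ThetaSideClosedM
import HarnessLib

/-!
# [IUTchIII] Corollary 3.12 at the M-LEVEL sharp setting of the datum's OWN Θ-ideles — the TWO-SIDED WINDOW for `−|log(Θ)|`:
# `−deĝ_lgp(P_Θ) ≤ −|log(Θ)|(setting) ≤ −|log(Θ)|(genuine input) ≤ −deĝ_lgp(P_Θ) + δ(I) + ((l+5)/4)·log π`
# (G1-Θ coda of `HOME/staging/w5/w5-d166/g4/G1-THETA-SHAPES.md`; the honest answer to the mint's «(or =)» for TARGET #2)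

PROOF-ONLY record file (D-0012; no definitions, no `Prop` facts) of the abc-iut cell (R2 S-chain seat abc-iut-s2-p9, gen 0; branch C
«abc ⇐ S», C-lead ruling C-R12 (e) «target #2′»). TAKES NO SIDE on [IUTchIII] Cor. 3.12. Composition BY NAME of three landed facts
about the M-level setting over the genuine carriers `K_{v̲}`, `v̲ ∈ V̲` ([IUTchI] Def. 3.1 (e)), of the DATUM'S OWN Θ-ideles
`tOfIdeleData D r` (abc-iut-w5-d166, read off abc-iut-S2's genuine idele data by abc-iut-w5-d033's `tThetaM`):

* LOWER: this seat's `neg_ndegLgp_le_negLogTheta_settingPrVolM_tOfIdeleData` (`Cor312PilotIdelesMThetaSide`, p440521: every Kummer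
  image of the Θ-pilot object lies in the hull — the trivial direction, Dupuy–Hilado Thm. 3.10.1), at both routes
  (`…settingPrVolSharpM…`: abc-iut-s2-p8's summand-route sharp setting IS `settingPrVolM` at the sharp binders by `rfl`;
  `…settingMSharp…`: abc-iut-w5-d166's frames route, the same number by abc-iut-w4-d013's two-routes identity p437121);
* UPPER: the G1-Θ closer `negLogTheta_settingMSharp_tOfIdeleData_le_genuine` (abc-iut-s2-p8 `Cor312ThetaSideClosedM`, p440655; the READ
  binder `hΘ` of branch C DISCHARGED: abc-iut-s2-p7's content bound, abc-iut-w5-d166's identification and reduction, this seat's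
  `ThetaFinite`/arch-zero/good-place-zero);
* GENUINE CEILING: abc-iut-S2/c312-d1's `hullEstimateOf_ofInput` (`LDHGenuine`: `negLogThetaNonarch ≤ −deĝ_lgp + explicitDelta`, the
  computable half of [IUTchIV] Thm. 1.10 Steps (v)–(viii)) and the definition `negLogTheta = negLogThetaNonarch + ((l+5)/4)·log π`.

So the typed `−|log(Θ)|` of the M-level setting of a genuine datum is a real number PINNED in the explicit window
`[−deĝ_lgp(P_Θ), −deĝ_lgp(P_Θ) + explicitDelta(I) + ((l+5)/4)·log π]` — `hΘ` is `≤` (never `=`: the setting's archimedean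
container is trivial while the genuine number carries `((l+5)/4)·log π > 0`; on the nonarchimedean side `=` is OPEN — print's
factorwise (Ind2) versus Dupuy–Hilado's full lattice group at RAMIFIED packets, STATUS 11:18Z (N1)).
[cite: Mochizuki2012, IUTchIII Cor. 3.12 p. 173–174] [cite: Mochizuki2012, IUTchIV Thm. 1.10 Steps (v)–(viii) p. 27–31]
[cite: DupuyHilado2025, §1 (1.1), Thm. 3.10.1] [claim: Mochizuki2012, status: disputed] for the quoted setting.
HONEST FRAMING: bookkeeping of landed bounds; nothing asserted or denied about Cor. 3.12 (`Cor312.Setting.Statement` untouched);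
typed ≠ proved; instantiated ≠ endorsed.
-/

noncomputable section

open Set Function NumberField IsDedekindDomain

namespace Summit.ABC.IUTFork.Thm311.Real

open Cor312 Cor312Vol Literature.IUT.LogThetaLattice Literature.IUT.LogVolume Literature.IUT.HodgeTheaters
  Literature.NumberTheory.NumberFields

variable {F K Fbar : Type} [Field F] [NumberField F] [Field K] [NumberField K] [Algebra F K]
  [Field Fbar] [Algebra F Fbar] [Algebra K Fbar] {E : WeierstrassCurve F} [E.IsElliptic] {l : ℕ}
  {Pb : BadPlacePredicates K} (D : InitialThetaData F K Fbar E l Pb) {logvK : PadicLogsVal K}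
  (hlog : LogvAnalyticVal logvK) (r : ThetaData.IdeleData D)
  (tq : ∀ (u : FinitePlace ℚ) (x : (thetaIndexOfInitial D).Fibre (Val.non u)),
    kOfM D (ratChar u) u (natCast_ratChar_mem u) x)
  (M : Type) [Field M] [NumberField M]
  (archPk : ∀ (j : (thetaIndexOfInitial D).Label) (vQ : (thetaIndexOfInitial D).VQ),
    Set ((logShellsOfInitialDH D logvK).Packet j vQ))
  (archSub : ∀ (j : (thetaIndexOfInitial D).Label) (v : (thetaIndexOfInitial D).V),
    Set ((logShellsOfInitialDH D logvK).Packet j ((thetaIndexOfInitial D).over v)))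
  (Ψ : ℤ → ∀ v : (thetaIndexOfInitial D).V, v ∈ (thetaIndexOfInitial D).Vbad →
    Set ((logShellsOfInitialDH D logvK).StarPacket v))
  (act : ℤ → ∀ v : (thetaIndexOfInitial D).V, v ∈ (thetaIndexOfInitial D).Vbad →
    (logShellsOfInitialDH D logvK).StarPacket v → Module.End ℚ ((logShellsOfInitialDH D logvK).StarPacket v))
  (Mmod : ℤ → ∀ j : (thetaIndexOfInitial D).LabelStar, Set ((logShellsOfInitialDH D logvK).GlobalPacket j.1))
  (region : ℤ → ∀ j : (thetaIndexOfInitial D).LabelStar, FinDivisor M → ∀ vQ : (thetaIndexOfInitial D).VQ,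
    Set ((logShellsOfInitialDH D logvK).Packet j.1 vQ))
  (n : ℤ) {HT : Type} {LogLink : HT → HT → Type} {IsFull : ∀ {s t : HT}, LogLink s t → Prop}
  (lat : LGPGaussianLogThetaLattice LogLink IsFull)
  {Frd : Type} {IsoF : Frd → Frd → Type} {Ob : Frd → Type} {realify : Frd → Frd} {Strip : Type}
  {IsoS : Strip → Strip → Type} {Mv : ∀ v : (thetaIndexOfInitial D).V, v ∈ (thetaIndexOfInitial D).Vbad → Type}
  [∀ v h, Monoid (Mv v h)]
  (sig : GlobalLGPFrobenioidSignature (thetaIndexOfInitial D).lstar (thetaIndexOfInitial D).V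
    (· ∈ (thetaIndexOfInitial D).Vbad) Frd IsoF Ob realify Strip IsoS Mv)
  (split : SplittingMonoids Mv) {ObΔ : Type} {N : ∀ v : (thetaIndexOfInitial D).V, v ∈ (thetaIndexOfInitial D).Vbad → Type}
  [∀ v h, Monoid (N v h)] (qData : QPilotData ObΔ N)
  (htq0 : ∀ u x, tq u x ≠ 0) (Sq : Finset (FinitePlace ℚ))
  (htq1 : ∀ (u : FinitePlace ℚ) (x : (thetaIndexOfInitial D).Fibre (Val.non u)), u ∉ Sq → ‖tq u x‖ = 1)

/-- **LOWER bound at abc-iut-s2-p8's summand-route sharp setting of the datum's own Θ-ideles**: `↑(−deĝ_lgp(P_Θ)) ≤ −|log(Θ)|`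
(this seat's `neg_ndegLgp_le_negLogTheta_settingPrVolM_tOfIdeleData`; `settingPrVolSharpM` IS `settingPrVolM` at the sharp binders
with abc-iut-w4-d013's `qSupport_finite_PrVolM_sharp`, by `rfl`). [cite: DupuyHilado2025, Thm. 3.10.1] -/
theorem neg_ndegLgp_le_negLogTheta_settingPrVolSharpM_tOfIdeleData :
    (((-LgpDivisor.ndegLgp (ThetaData.volumeInputOf D r).X.thetaPilot : ℝ)) : WithTop ℝ) ≤
      (settingPrVolSharpM D hlog (tOfIdeleData D r) tq M archPk archSub Ψ act Mmod region n lat sig split qData htq0 Sq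
        htq1).negLogTheta :=
  neg_ndegLgp_le_negLogTheta_settingPrVolM_tOfIdeleData D hlog r M archPk archSub Ψ act Mmod region n lat sig split qData tq htq0
    (qSupport_finite_PrVolM_sharp D hlog M archPk archSub Ψ act Mmod region n qData tq htq0 Sq htq1)

/-- **LOWER bound at abc-iut-w5-d166's frames-route sharp setting** `settingMSharp` of the datum's own Θ-ideles (the same number:
abc-iut-w4-d013's two-routes identity, in abc-iut-s2-p8's form `negLogTheta_settingMSharp_eq_settingPrVolSharpM`).
[cite: DupuyHilado2025, Thm. 3.10.1] -/
theorem neg_ndegLgp_le_negLogTheta_settingMSharp_tOfIdeleData :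
    (((-LgpDivisor.ndegLgp (ThetaData.volumeInputOf D r).X.thetaPilot : ℝ)) : WithTop ℝ) ≤
      (settingMSharp D hlog M archPk archSub Ψ act Mmod region n lat sig split qData (tOfIdeleData D r) tq htq0 Sq
        htq1).negLogTheta := by
  rw [negLogTheta_settingMSharp_eq_settingPrVolSharpM]
  exact neg_ndegLgp_le_negLogTheta_settingPrVolSharpM_tOfIdeleData D hlog r tq M archPk archSub Ψ act Mmod region n lat sig
    split qData htq0 Sq htq1

/-- **The genuine ceiling**: abc-iut-S2's `−|log(Θ)|` of the input is at most `−deĝ_lgp(P_Θ) + explicitDelta + ((l+5)/4)·log π`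
(`hullEstimateOf_ofInput` plus the definition of `negLogTheta`; [IUTchIV] Thm. 1.10 Steps (v)–(viii), the computable half).
[cite: Mochizuki2012, IUTchIV Thm. 1.10 Steps (v)–(viii) p. 27–31] -/
theorem negLogTheta_volumeInputOf_le_explicit :
    (ThetaData.volumeInputOf D r).negLogTheta ≤
      -LgpDivisor.ndegLgp (ThetaData.volumeInputOf D r).X.thetaPilot + DHData.explicitDelta (ThetaData.volumeInputOf D r) +
        ThetaVolumeInput.archLogTheta (ThetaData.volumeInputOf D r).l := by
  have h := DHData.hullEstimateOf_ofInput (ThetaData.volumeInputOf D r)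
  unfold ThetaVolumeInput.HullEstimateOf at h
  unfold ThetaVolumeInput.negLogTheta
  linarith

/-- **THE WINDOW (frames route).** For the M-level sharp setting of a genuine datum's own Θ-ideles:
`↑(−deĝ_lgp(P_Θ)) ≤ −|log(Θ)|(setting) ≤ ↑(−|log(Θ)|(input)) ≤ ↑(−deĝ_lgp(P_Θ) + explicitDelta + ((l+5)/4)·log π)` — lower bound
(this seat), the discharged READ binder `hΘ` (G1-Θ closer, abc-iut-s2-p8 p440655), genuine ceiling (abc-iut-S2). In particular the
setting's `−|log(Θ)|` is a real number within `explicitDelta + ((l+5)/4)·log π` of `−deĝ_lgp(P_Θ)`; `hΘ` is `≤`, not `=`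
(the setting's archimedean container is trivial). [cite: Mochizuki2012, IUTchIII Cor. 3.12 p. 173–174] -/
theorem negLogTheta_settingMSharp_tOfIdeleData_window :
    (((-LgpDivisor.ndegLgp (ThetaData.volumeInputOf D r).X.thetaPilot : ℝ)) : WithTop ℝ) ≤
        (settingMSharp D hlog M archPk archSub Ψ act Mmod region n lat sig split qData (tOfIdeleData D r) tq htq0 Sq
          htq1).negLogTheta ∧
      (settingMSharp D hlog M archPk archSub Ψ act Mmod region n lat sig split qData (tOfIdeleData D r) tq htq0 Sq
          htq1).negLogTheta ≤ (((ThetaData.volumeInputOf D r).negLogTheta : ℝ) : WithTop ℝ) ∧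
      (((ThetaData.volumeInputOf D r).negLogTheta : ℝ) : WithTop ℝ) ≤
        ((-LgpDivisor.ndegLgp (ThetaData.volumeInputOf D r).X.thetaPilot + DHData.explicitDelta (ThetaData.volumeInputOf D r) +
          ThetaVolumeInput.archLogTheta (ThetaData.volumeInputOf D r).l : ℝ) : WithTop ℝ) :=
  ⟨neg_ndegLgp_le_negLogTheta_settingMSharp_tOfIdeleData D hlog r tq M archPk archSub Ψ act Mmod region n lat sig split qData htq0
      Sq htq1,
    negLogTheta_settingMSharp_tOfIdeleData_le_genuine D hlog r tq M archPk archSub Ψ act Mmod region n lat sig split qData htq0 Sq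
      htq1,
    WithTop.coe_le_coe.mpr (negLogTheta_volumeInputOf_le_explicit D r)⟩

/-- **THE WINDOW (summand route)** — the same three inequalities at abc-iut-s2-p8's `settingPrVolSharpM`.
[cite: Mochizuki2012, IUTchIII Cor. 3.12 p. 173–174] -/
theorem negLogTheta_settingPrVolSharpM_tOfIdeleData_window :
    (((-LgpDivisor.ndegLgp (ThetaData.volumeInputOf D r).X.thetaPilot : ℝ)) : WithTop ℝ) ≤
        (settingPrVolSharpM D hlog (tOfIdeleData D r) tq M archPk archSub Ψ act Mmod region n lat sig split qData htq0 Sq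
          htq1).negLogTheta ∧
      (settingPrVolSharpM D hlog (tOfIdeleData D r) tq M archPk archSub Ψ act Mmod region n lat sig split qData htq0 Sq
          htq1).negLogTheta ≤ (((ThetaData.volumeInputOf D r).negLogTheta : ℝ) : WithTop ℝ) ∧
      (((ThetaData.volumeInputOf D r).negLogTheta : ℝ) : WithTop ℝ) ≤
        ((-LgpDivisor.ndegLgp (ThetaData.volumeInputOf D r).X.thetaPilot + DHData.explicitDelta (ThetaData.volumeInputOf D r) +
          ThetaVolumeInput.archLogTheta (ThetaData.volumeInputOf D r).l : ℝ) : WithTop ℝ) :=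
  ⟨neg_ndegLgp_le_negLogTheta_settingPrVolSharpM_tOfIdeleData D hlog r tq M archPk archSub Ψ act Mmod region n lat sig split qData
      htq0 Sq htq1,
    negLogTheta_settingPrVolSharpM_tOfIdeleData_le_genuine D hlog r tq M archPk archSub Ψ act Mmod region n lat sig split qData htq0
      Sq htq1,
    WithTop.coe_le_coe.mpr (negLogTheta_volumeInputOf_le_explicit D r)⟩

/-- **`−|log(Θ)|` of the M-level setting of a genuine datum's own Θ-ideles IS A REAL NUMBER within an explicit distance of
`−deĝ_lgp(P_Θ)`**: there is `x : ℝ` with `negLogTheta = ↑x` and `−deĝ_lgp(P_Θ) ≤ x ≤ −deĝ_lgp(P_Θ) + explicitDelta + ((l+5)/4)·log π`.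
[cite: Mochizuki2012, IUTchIII Cor. 3.12 p. 173–174] -/
theorem exists_negLogTheta_settingMSharp_tOfIdeleData_eq_coe :
    ∃ x : ℝ, (settingMSharp D hlog M archPk archSub Ψ act Mmod region n lat sig split qData (tOfIdeleData D r) tq htq0 Sq
        htq1).negLogTheta = (x : WithTop ℝ) ∧
      -LgpDivisor.ndegLgp (ThetaData.volumeInputOf D r).X.thetaPilot ≤ x ∧
      x ≤ -LgpDivisor.ndegLgp (ThetaData.volumeInputOf D r).X.thetaPilot + DHData.explicitDelta (ThetaData.volumeInputOf D r) +
        ThetaVolumeInput.archLogTheta (ThetaData.volumeInputOf D r).l := by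
  obtain ⟨h1, h2, h3⟩ := negLogTheta_settingMSharp_tOfIdeleData_window D hlog r tq M archPk archSub Ψ act Mmod region n lat sig
    split qData htq0 Sq htq1
  have hne : (settingMSharp D hlog M archPk archSub Ψ act Mmod region n lat sig split qData (tOfIdeleData D r) tq htq0 Sq
      htq1).negLogTheta ≠ ⊤ := ne_top_of_le_ne_top WithTop.coe_ne_top h2
  obtain ⟨x, hx⟩ := WithTop.ne_top_iff_exists.mp hne
  refine ⟨x, hx.symm, ?_, ?_⟩
  · rw [← hx] at h1
    exact WithTop.coe_le_coe.mp h1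
  · rw [← hx] at h2
    exact (WithTop.coe_le_coe.mp h2).trans (WithTop.coe_le_coe.mp h3)

end Summit.ABC.IUTFork.Thm311.Real

end
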